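import Summits.HodgeConjecture.HodgeConjecture.Theorems.TropicalKugaSatakeCayleyDefs
import Summits.HodgeConjecture.HodgeConjecture.Theorems.TropicalKugaSatakeCayleyEffectiveCayleyNonRealizabilitySixthDirectionRung
import HarnessLib

/-!
# Crux `EffectiveCayleyNonRealizability` (stmt-HodgeConjecture-18569), line `formal_rational`:
# the registered rung `stub_rung_sixthDirection` stated LITERALLY

With the rung's devices `ksSixth` / `ksMatrixPlus` / `ksMatrixPlusPoly` / `evalCell₆` / `evalChain₆`
available in Theorems (`TropicalKugaSatakeCayleyDefs.lean`, same bodies as the skeleton-local ones of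
`Cruxes/EffectiveCayleyNonRealizability/Lines/formal_rational.lean`), the registered signature of
`stub_rung_sixthDirection` is stated verbatim and closed by
`stub_rung_sixthDirection_unfolded`
(`…SixthDirectionRung.lean`: the kernel certificate `K₊ ∩ ℚ^{28×28} = ℚ • 1`), whose statement is the
same signature with the devices unfolded (definitional unfolding). No new mathematics; no
definition, no sorry.
References: [MikhalkinZharkov2014Eigenwave] G. Mikhalkin, I. Zharkov, Tropical eigenwave and
intermediate Jacobians, LN UMI 15 (2014), Thm. 5.4; [Zharkov2020TropicalWeil] I. Zharkov,
arXiv:2002.02347, pp. 2–3.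
-/

noncomputable section

-- `Summit.HodgeConjecture.HodgeConjecture.…` is the mandated namespace (single-conjunct summit).
set_option linter.dupNamespace false

namespace Summit.HodgeConjecture.HodgeConjecture.Theorems.EffectiveCayleyNonRealizability

open Literature.AlgebraicGeometry.Tropical Literature.AlgebraicGeometry.Tropical.TropicalTorus
open Summit.HodgeConjecture.HodgeConjecture.Theorems.TropicalKugaSatakeCayley

/-- **Registered rung `stub_rung_sixthDirection`** (crux `EffectiveCayleyNonRealizability`,
stmt-HodgeConjecture-18569, line `formal_rational`), verbatim: an affine-linear formal chain over
`ℚ[s₀,…,s₅]` that is formally a cycle of the six-parameter family `F₊ = F_KS ⊕ ℚ B₆` and is effective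
with constant period class `Mq` on a non-empty open set of positive-definite parameters has
`Mq ∈ ℚ • 1` ("fully flexible ⟹ Lefschetz", `dim Hdg₂(F₊) = 1`). Proof: the kernel certificate
`stub_rung_sixthDirection_unfolded`.
[cite: MikhalkinZharkov2014Eigenwave, Thm. 5.4] [cite: Zharkov2020TropicalWeil, pp. 2–3] -/
theorem stub_rung_sixthDirection : ∀ 𝒵 : Chain (MvPolynomial (Fin 6) ℚ) 8 2, 𝒵.IsAffineLinear → 𝒵.IsCycle ksMatrixPlusPoly → ∀ V : Set (Fin 6 → ℝ), IsOpen V → V.Nonempty → (∀ s ∈ V, (ksMatrixPlus s).PosDef) → ∀ Mq : Matrix (Sub 8 2) (Sub 8 2) ℚ, (∀ s ∈ V, (evalChain₆ s 𝒵).Effective ∧ compound 2 (ksMatrixPlus s)⁻¹ * (evalChain₆ s 𝒵).classOf = Mq.map (algebraMap ℚ ℝ)) → ∃ r : ℚ, Mq = r • (1 : Matrix (Sub 8 2) (Sub 8 2) ℚ) :=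
  stub_rung_sixthDirection_unfolded

end Summit.HodgeConjecture.HodgeConjecture.Theorems.EffectiveCayleyNonRealizability

end
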